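import Summits.Ventures.Crystal3D.Theorems.StickyWulffConstantTextureBuildMeshV4
import Summits.Ventures.Crystal3D.Theorems.StickyWulffConstantTextureBuildCutLevel
import Summits.Ventures.Crystal3D.Theorems.StickyWulffConstantTextureLiminfCellFlux
import Summits.Ventures.Crystal3D.Theorems.StickyWulffConstantTextureBuildFccCell
import HarnessLib

/-!
# TB-energy blueprint, stub INPUT (cut part): every wall cell of a v4 mesh has a GOOD CUT LEVEL
# (lane T, crux `TextureLiminfV5`, stmt-Ventures-23912; blueprint TexShadowTB `stub_input` / `Good.hcut`; brick B5 `exists_cut_level` + the placement plumbing)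

HONEST FRAMING. Venture `Summits/Ventures/Crystal3D` (cell `crystal3d-full`), route `route-Ventures-StickyWulffConstant`, helper `--supports` the
law-v5 crux `TextureLiminfV5` (stmt-Ventures-23912).  Geometry/measure plumbing (standard axioms; no mesh constructed; F-C1 not moved).

WHAT.  For a wall cell `k` of a v4 mesh (regime `1 ≤ R₀`): the placed disc `D := rigid M t '' wallSlice ρ` is measurable, has volume `πρ²`, lies in the
closed prism (`hPZ`, via `wallSlice ⊆ cyl`) and in the unit model-height layer; the placed model slabs ARE the tents' slabs (`hpres₁/₂`), so the finite
partial sums of the cell's CHARGE series, transported to actual space, are bounded by `WallCell.charge`; hence B5 `exists_cut_level` yields a cut level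
`τ ∈ (0,1)` whose cut facets, weighted by the law table, cost at most `charge + 13/25·ex` — the clause `Good.hcut` of the blueprint.
* `image_rigid_eq_preimage`, `volume_image_rigid`, `image_rigid_laySlab`, `inner_frame_rigid`, `CellCover.height_eq_inner_frame`,
  `wallSlice_subset_cyl`, `isBounded_wallSlice`, `WallCell.summable_charge`, `WallCell.sum_le_charge`, `Mesh₄.exists_good_cut`.
-/

noncomputable section

open scoped BigOperators InnerProductSpace ENNReal
open MeasureTheory Set

namespace Summit.Ventures.Crystal3D.Cruxes.TextureLiminf.TexShadow

open Summit.Ventures.Crystal3D Summit.Ventures.Crystal3D.Theorems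
open Summit.Ventures.Crystal3D.TentCertificate (mem_laySlab_iff height_move move_symm)

/-! ### Rigid motions: images, volumes, slabs -/

section rigid

variable (M : E3 ≃ₗᵢ[ℝ] E3) (t : E3)

/-- The image under a rigid motion is the preimage under its inverse. -/
theorem image_rigid_eq_preimage (A : Set E3) : rigid M t '' A = (fun p => M.symm (p - t)) ⁻¹' A := by
  ext p
  constructor
  · rintro ⟨a, ha, rfl⟩
    simpa [rigid] using ha
  · intro hp
    exact ⟨M.symm (p - t), hp, rigid_symm_apply M t p⟩

/-- The inverse motion preserves volume. -/
theorem measurePreserving_rigid_symm : MeasurePreserving (fun p : E3 => M.symm (p - t)) volume volume := by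
  have h := measurePreserving_move M.symm 0 (-t)
  have he : (fun z : E3 => M.symm (-t + z) + 0) = fun p => M.symm (p - t) := by
    funext z; rw [add_zero, neg_add_eq_sub]
  rw [he] at h; exact h

/-- **Rigid motions preserve the volume of measurable sets.** -/
theorem volume_image_rigid {A : Set E3} (hA : MeasurableSet A) : volume (rigid M t '' A) = volume A := by
  rw [image_rigid_eq_preimage]
  exact (measurePreserving_rigid_symm M t).measure_preimage hA.nullMeasurableSet

/-- The image of a measurable set under a rigid motion is measurable. -/
theorem measurableSet_image_rigid {A : Set E3} (hA : MeasurableSet A) : MeasurableSet (rigid M t '' A) := by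
  rw [image_rigid_eq_preimage]
  exact (measurePreserving_rigid_symm M t).measurable hA

/-- **Aligned presentations have the same slabs**: if the placed model presentation `(L₁, s₁)` is the presentation `(L, s)`, the placed model
slabs are the slabs. -/
theorem image_rigid_laySlab {L₁ L : E3 ≃ₗᵢ[ℝ] E3} {s₁ s : E3} (hpres : ∀ r : E3, rigid M t (L₁ r + s₁) = L r + s) (i : ℤ) :
    rigid M t '' laySlab L₁ s₁ i = laySlab L s i := by
  ext y
  constructor
  · rintro ⟨z, hz, rfl⟩
    rw [mem_laySlab_iff] at hz ⊢
    have hz' : z = L₁ (L₁.symm (z - s₁)) + s₁ := (move_symm L₁ s₁ z).symm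
    rw [hz', hpres, height_move]
    exact hz
  · intro hy
    rw [mem_laySlab_iff] at hy
    refine ⟨L₁ (L.symm (y - s)) + s₁, ?_, ?_⟩
    · rw [mem_laySlab_iff, height_move]; exact hy
    · rw [hpres]; exact move_symm L s y

/-- The frame coordinate along `M e₃` of a placed point. -/
theorem inner_frame_rigid (q : E3) : ⟪M e₃, rigid M t q⟫_ℝ = q 2 + ⟪M e₃, t⟫_ℝ := by
  simp only [rigid, inner_add_right, LinearIsometryEquiv.inner_map_map]
  simp [e₃, EuclideanSpace.inner_single_left]

end rigid

namespace CellCover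

variable {C R₀ : ℝ} {N : ℕ} {x : Fin N → E3}

/-- The model height of cell `k` is the inner product with the placed layer normal, shifted. -/
theorem height_eq_inner_frame (cv : CellCover C R₀ N x) (k : Fin cv.nk) (y : E3) :
    cv.height k y = ⟪(cv.cell k).M e₃, y⟫_ℝ - ⟪(cv.cell k).M e₃, (cv.cell k).t⟫_ℝ := by
  have h := inner_frame_rigid (cv.cell k).M (cv.cell k).t ((cv.cell k).M.symm (y - (cv.cell k).t))
  rw [rigid_symm_apply] at h
  unfold CellCover.height
  linarith

end CellCover

/-! ### The wall slice -/

/-- In the regime `1 ≤ R₀` the unit slice lies in the cell's cylinder. -/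
theorem wallSlice_subset_cyl {R₀ h ρ : ℝ} (hR₀ : 1 ≤ R₀) (hh : 0 ≤ h) : wallSlice ρ ⊆ cyl R₀ h ρ := by
  intro q hq
  simp only [wallSlice, mem_setOf_eq] at hq
  simp only [cyl, mem_setOf_eq]
  exact ⟨by linarith [hq.1], by linarith [hq.2.1], hq.2.2⟩

/-- The wall slice is bounded. -/
theorem isBounded_wallSlice (ρ : ℝ) : Bornology.IsBounded (wallSlice ρ) := by
  refine (Metric.isBounded_closedBall (x := (0 : E3)) (r := |ρ| + 1)).subset fun q hq => ?_
  simp only [wallSlice, mem_setOf_eq] at hq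
  rw [Metric.mem_closedBall, dist_zero_right, EuclideanSpace.norm_eq]
  have h3 : ∑ i : Fin 3, ‖q i‖ ^ 2 = q 0 ^ 2 + q 1 ^ 2 + q 2 ^ 2 := by
    simp [Fin.sum_univ_three, Real.norm_eq_abs, sq_abs]
  rw [h3]
  have hρ : ρ ^ 2 = |ρ| ^ 2 := (sq_abs ρ).symm
  have h22 : q 2 ^ 2 ≤ 1 := by nlinarith [hq.1, hq.2.1]
  calc Real.sqrt (q 0 ^ 2 + q 1 ^ 2 + q 2 ^ 2) ≤ Real.sqrt ((|ρ| + 1) ^ 2) :=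
        Real.sqrt_le_sqrt (by nlinarith [hq.2.2, abs_nonneg ρ])
    _ = |ρ| + 1 := Real.sqrt_sq (by positivity)

/-! ### The charge series of a wall cell -/

namespace WallCell

variable {C R₀ : ℝ} (k : WallCell C R₀)

/-- the terms of the charge series -/
def chargeTerm (ij : ℤ × ℤ) : ℝ :=
  k.c ij.1 ij.2 * (volume (wallSlice k.ρ ∩ laySlab k.L₁ k.s₁ ij.1 ∩ laySlab k.L₂ k.s₂ ij.2)).toReal

/-- `charge` is the sum of the charge series (definitional). -/
theorem charge_eq_tsum : k.charge = ∑' ij : ℤ × ℤ, k.chargeTerm ij := rfl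

/-- The charge terms are nonnegative. -/
theorem chargeTerm_nonneg (ij : ℤ × ℤ) : 0 ≤ k.chargeTerm ij := mul_nonneg (k.hadm.1 _ _) ENNReal.toReal_nonneg

/-- The charge series is finitely supported, hence summable. -/
theorem summable_charge : Summable k.chargeTerm := by
  classical
  have hfin₁ := finite_slabs_meeting k.L₁ k.s₁ (isBounded_wallSlice k.ρ)
  have hfin₂ := finite_slabs_meeting k.L₂ k.s₂ (isBounded_wallSlice k.ρ)
  refine summable_of_ne_finset_zero (s := hfin₁.toFinset ×ˢ hfin₂.toFinset) fun ij hij => ?_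
  rw [Finset.mem_product, not_and_or] at hij
  have hempty : wallSlice k.ρ ∩ laySlab k.L₁ k.s₁ ij.1 ∩ laySlab k.L₂ k.s₂ ij.2 = ∅ := by
    rcases hij with h | h
    · rw [Set.Finite.mem_toFinset, mem_setOf_eq, not_nonempty_iff_eq_empty] at h
      ext q; constructor
      · rintro ⟨⟨hq, h1⟩, -⟩
        have : q ∈ laySlab k.L₁ k.s₁ ij.1 ∩ wallSlice k.ρ := ⟨h1, hq⟩
        rw [h] at this; exact this.elim
      · intro hq; exact hq.elim
    · rw [Set.Finite.mem_toFinset, mem_setOf_eq, not_nonempty_iff_eq_empty] at h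
      ext q; constructor
      · rintro ⟨⟨hq, -⟩, h2⟩
        have : q ∈ laySlab k.L₂ k.s₂ ij.2 ∩ wallSlice k.ρ := ⟨h2, hq⟩
        rw [h] at this; exact this.elim
      · intro hq; exact hq.elim
  simp [chargeTerm, hempty]

/-- **Finite partial sums of the charge series are bounded by the charge.** -/
theorem sum_le_charge (F : Finset (ℤ × ℤ)) : ∑ ij ∈ F, k.chargeTerm ij ≤ k.charge := by
  rw [charge_eq_tsum]
  exact k.summable_charge.sum_le_tsum F fun ij _ => k.chargeTerm_nonneg ij

end WallCell

/-! ### A good cut level for every wall cell -/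

namespace Mesh₄

variable {C R₀ : ℝ} {N : ℕ} {x : Fin N → E3} {rc : RiseredCover C R₀ N x} {δ : ℝ} (μ : Mesh₄ rc δ)

/-- **Every wall cell of a v4 mesh has a GOOD CUT LEVEL** (regime `1 ≤ R₀`): a `τ ∈ (0,1)` whose cut facets, weighted by the law table and indexed by
the TENTS' slab pairs, cost at most `charge + 13/25·ex`. -/
theorem exists_good_cut (hR₀ : 1 ≤ R₀) (k : Fin rc.nk) :
    ∃ τ ∈ Set.Ioo (0 : ℝ) 1, ∀ F : Finset (ℤ × ℤ),
      ∑ ij ∈ F, (rc.cell k).c ij.1 ij.2 * facetArea (closure (polytope (μ.HP k)) ∩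
        closure (laySlab (rc.tent (μ.fk k)).L (rc.tent (μ.fk k)).s ij.1) ∩ closure (laySlab (rc.tent (μ.gk k)).L (rc.tent (μ.gk k)).s ij.2) ∩
        {y : E3 | ⟪(rc.cell k).M e₃, y⟫_ℝ = ⟪(rc.cell k).M e₃, (rc.cell k).t⟫_ℝ + τ}) ((rc.cell k).M e₃) ≤
      (rc.cell k).charge + 13 / 25 * μ.ex k := by
  -- notation
  set M := (rc.cell k).M with hM
  set t := (rc.cell k).t with ht
  set ρ := (rc.cell k).ρ with hρ
  have hρ0 : 0 ≤ ρ := le_trans (by linarith) (rc.cell k).hρ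
  set D : Set E3 := rigid M t '' wallSlice ρ with hD
  have hDm : MeasurableSet D := measurableSet_image_rigid M t (measurableSet_wallSlice ρ)
  -- the disc lies in the closed prism
  have hDP : D ⊆ closure (polytope (μ.HP k)) := by
    refine Subset.trans ?_ (μ.hPZ k)
    exact image_mono (wallSlice_subset_cyl hR₀ (rc.cell k).hh)
  -- and in the unit layer
  have hDsl : D ⊆ {y : E3 | ⟪M e₃, t⟫_ℝ ≤ ⟪M e₃, y⟫_ℝ ∧ ⟪M e₃, y⟫_ℝ ≤ ⟪M e₃, t⟫_ℝ + 1} := by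
    rintro y ⟨q, hq, rfl⟩
    simp only [wallSlice, mem_setOf_eq] at hq
    simp only [mem_setOf_eq, inner_frame_rigid]
    exact ⟨by linarith [hq.1], by linarith [hq.2.1]⟩
  -- its volume
  have hDvol : volume D = ENNReal.ofReal (Real.pi * ρ ^ 2) := by
    rw [hD, volume_image_rigid M t (measurableSet_wallSlice ρ), volume_wallSlice ρ hρ0]
  -- the slice excess
  have hex : (volume (polytope (μ.HP k) ∩ {y : E3 | ⟪M e₃, t⟫_ℝ ≤ ⟪M e₃, y⟫_ℝ ∧ ⟪M e₃, y⟫_ℝ ≤ ⟪M e₃, t⟫_ℝ + 1})).toReal ≤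
      Real.pi * ρ ^ 2 + μ.ex k := by
    have hset : {y : E3 | ⟪M e₃, t⟫_ℝ ≤ ⟪M e₃, y⟫_ℝ ∧ ⟪M e₃, y⟫_ℝ ≤ ⟪M e₃, t⟫_ℝ + 1} = {y | 0 ≤ rc.height k y ∧ rc.height k y ≤ 1} := by
      ext y; simp only [mem_setOf_eq, CellCover.height_eq_inner_frame]; constructor <;> rintro ⟨h1, h2⟩ <;> constructor <;> linarith
    rw [hset]; exact μ.hex k
  -- the transported charge bound
  have hcharge : ∀ F : Finset (ℤ × ℤ), ∑ ij ∈ F, (rc.cell k).c ij.1 ij.2 *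
      (volume (D ∩ laySlab (rc.tent (μ.fk k)).L (rc.tent (μ.fk k)).s ij.1 ∩ laySlab (rc.tent (μ.gk k)).L (rc.tent (μ.gk k)).s ij.2)).toReal ≤
      (rc.cell k).charge := by
    intro F
    refine le_trans (le_of_eq (Finset.sum_congr rfl fun ij _ => ?_)) ((rc.cell k).sum_le_charge F)
    -- the placed slab-pair piece of the disc is the image of the model one
    have h1 := image_rigid_laySlab M t (μ.hpres₁ k).1 ij.1
    have h2 := image_rigid_laySlab M t (μ.hpres₂ k).1 ij.2
    have himg : D ∩ laySlab (rc.tent (μ.fk k)).L (rc.tent (μ.fk k)).s ij.1 ∩ laySlab (rc.tent (μ.gk k)).L (rc.tent (μ.gk k)).s ij.2 =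
        rigid M t '' (wallSlice ρ ∩ laySlab (rc.cell k).L₁ (rc.cell k).s₁ ij.1 ∩ laySlab (rc.cell k).L₂ (rc.cell k).s₂ ij.2) := by
      rw [image_inter (rigid_injective M t), image_inter (rigid_injective M t), h1, h2]
    show _ = (rc.cell k).toWallCell.chargeTerm ij
    unfold WallCell.chargeTerm
    rw [himg, volume_image_rigid M t (((measurableSet_wallSlice ρ).inter (TentCertificate.isOpen_laySlab _ _ _).measurableSet).inter
      (TentCertificate.isOpen_laySlab _ _ _).measurableSet)]
  -- B5
  exact exists_cut_level (norm_frame_e₃ M) ⟪M e₃, t⟫_ℝ (μ.HP k) (μ.hPbd k) (μ.hPunit k) hDm hDP hDsl hDvol hex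
    (rc.tent (μ.fk k)).L (rc.tent (μ.gk k)).L (rc.tent (μ.fk k)).s (rc.tent (μ.gk k)).s (rc.cell k).c
    (fun i j => (rc.cell k).hadm.1 i j) (fun i j => (rc.cell k).hadm.2.1 i j) hcharge

end Mesh₄

end Summit.Ventures.Crystal3D.Cruxes.TextureLiminf.TexShadow

end
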